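import Summits.CriticalPhenomena.PercolationContinuityZ3.Theorems.PercNearOneGluingNoHeavyLowerTailFourPointAtoms
import Literature.Probability.Percolation.ProdBernoulliRusso

/-!
# Two-copy fibre bridge for monotone-map kernel theorems (four marked points, all `n`, all weights)

Support file for crux `stmt-CriticalPhenomena-4575` (master-family programme, quadratic four-point row `Q44b`),
seat `prim-l12-p6` gen 10.  Bookkeeping + one analytic lemma; no named facts, no sorries.

The nine-type / OTA programme (`prim-bnk-1` gen 16–17, `prim-l12-p6` gen 9–10; files `…NineTypeAnchor`,
`…NineTypeAllH`) proves FIBRE statements: for every monotone map `P` from the subsets of a finite set into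
the partition lattice of the four marked points, an antipodal count `Σ_T κ(P T, P Tᶜ)` is nonnegative.
This file is the LAW-LEVEL BRIDGE: such a kernel `κ : Fin 15 → Fin 15 → ℤ` (indices = the 15 four-point cells
of `FourPointAtoms.pat4`) satisfies, for every finite weighted graph `(Fin n, w)` and all marked points
`a b c y`,  `0 ≤ Σ_{i,j} κ i j · cell i · cell j`  (`sum_kernel_cell_nonneg`).

Mechanism (the standard two-copy fibre expansion, here in `Finset` form): `cell i = Σ_{S ⊆ E} [S ∈ atom i] w(S)`
(`prodBernoulli_real_eq_sum_powerset`, `E` = all of `Sym2 (Fin n)`), so the bilinear form is a sum over pairs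
`(S, S')`; grouping the pairs by `(M, C) = (S ∆ S', S ∩ S')` the weight `w(C ∪ T) w(C ∪ (M ∖ T))` does not depend
on `T ⊆ M` (`wt_pair_eq`) and is nonnegative, and the remaining count `Σ_{T ⊆ M} κ(prof(C ∪ T), prof(C ∪ (M∖T)))`
is an antipodal sum for the monotone, equivalence-valued connection-profile map `T ↦ prof (C ∪ T)` on the
subsets of `M`, which is what `GoodKernel κ` controls.  Profiles are `Fin 4 → Fin 4 → Bool`
(reachability of the marked points); a cell `i` is the event `prof = profOf (pat4 i)`.
-/

noncomputable section

namespace Summit.CriticalPhenomena.PercolationContinuityZ3.Theorems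

open MeasureTheory Set Finset Literature.Probability.Percolation
open Literature.Probability.LatticeModels (prodBernoulli)
open Summit.CriticalPhenomena.PercolationContinuityZ3.Cruxes.AdditiveGluing.TieLine.ConnAtoms

namespace TwoCopyMono

/-! ## Profiles of four marked points -/

/-- A connection profile of four marked points: which pairs are joined. [this work] -/
abbrev Prof := Fin 4 → Fin 4 → Bool

/-- The profile of a labeling `π : Fin 4 → Fin 4` (points `i, j` joined iff equal labels). [this work] -/
def profOf (π : Fin 4 → Fin 4) : Prof := fun i j => decide (π i = π j)

/-- Pointwise order on profiles: `u ≤ v` iff every pair joined in `u` is joined in `v`. [this work] -/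
structure ProfLE (u v : Prof) : Prop where
  /-- every pair joined in `u` is joined in `v` -/
  le : ∀ i j, u i j = true → v i j = true

/-- A profile is an equivalence (reflexive, symmetric, transitive). [this work] -/
structure IsEqv (u : Prof) : Prop where
  /-- reflexive -/
  refl : ∀ i, u i i = true
  /-- symmetric -/
  symm : ∀ i j, u i j = true → u j i = true
  /-- transitive -/
  trans : ∀ i j k, u i j = true → u j k = true → u i k = true

/-- Lift of a cell kernel `κ : Fin 15 → Fin 15 → ℤ` to profiles (zero off the 15 partition profiles). [this work] -/
def liftK (κ : Fin 15 → Fin 15 → ℤ) (u v : Prof) : ℤ :=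
  ∑ i : Fin 15, ∑ j : Fin 15, if u = profOf (FourPointAtoms.pat4 i) ∧ v = profOf (FourPointAtoms.pat4 j) then κ i j else 0

/-- **Good kernels**: the antipodal count is nonnegative for every monotone equivalence-valued profile map on
the subsets of a finite type.  This is the fibre statement proved by the nine-type files. [this work] -/
structure GoodKernel (κ : Fin 15 → Fin 15 → ℤ) : Prop where
  /-- the antipodal count of every monotone equivalence-valued profile map is nonnegative -/
  nonneg : ∀ (γ : Type) [Fintype γ] [DecidableEq γ] (P : Finset γ → Prof),
    (∀ S T : Finset γ, S ⊆ T → ProfLE (P S) (P T)) → (∀ S : Finset γ, IsEqv (P S)) →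
      0 ≤ ∑ T : Finset γ, liftK κ (P T) (P Tᶜ)

/-- The zero kernel is good (sanity witness). [this work] -/
theorem goodKernel_zero : GoodKernel (fun _ _ => 0) :=
  ⟨fun γ _ _ P _ _ => Finset.sum_nonneg fun T _ => by
    unfold liftK; exact Finset.sum_nonneg fun i _ => Finset.sum_nonneg fun j _ => by split_ifs <;> exact le_refl _⟩

/-! ## The profile of a configuration -/

variable {n : ℕ}

open Classical in
/-- The connection profile of the marked points `a b c y` in the configuration `ω`. [this work] -/
def prof (a b c y : Fin n) (ω : BondConfig (Fin n)) : Prof :=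
  fun i j => decide ((openGraph ω).Reachable (FourPointAtoms.quad a b c y i) (FourPointAtoms.quad a b c y j))

open Classical in
/-- Reading a profile entry. [this work] -/
theorem prof_true_iff (a b c y : Fin n) (ω : BondConfig (Fin n)) (i j : Fin 4) :
    prof a b c y ω i j = true ↔ (openGraph ω).Reachable (FourPointAtoms.quad a b c y i) (FourPointAtoms.quad a b c y j) := by
  unfold prof; exact decide_eq_true_iff

/-- Profiles of configurations are equivalences. [folklore] -/
theorem prof_isEqv (a b c y : Fin n) (ω : BondConfig (Fin n)) : IsEqv (prof a b c y ω) := by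
  refine ⟨fun i => ?_, fun i j h => ?_, fun i j k h1 h2 => ?_⟩
  · exact (prof_true_iff a b c y ω i i).2 (SimpleGraph.Reachable.refl _)
  · exact (prof_true_iff a b c y ω j i).2 ((prof_true_iff a b c y ω i j).1 h).symm
  · exact (prof_true_iff a b c y ω i k).2 (((prof_true_iff a b c y ω i j).1 h1).trans ((prof_true_iff a b c y ω j k).1 h2))

/-- Profiles are monotone in the configuration. [folklore] -/
theorem prof_mono (a b c y : Fin n) {ω ω' : BondConfig (Fin n)} (h : ω ⊆ ω') :
    ProfLE (prof a b c y ω) (prof a b c y ω') := by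
  refine ⟨fun i j hij => ?_⟩
  exact (prof_true_iff a b c y ω' i j).2 (((prof_true_iff a b c y ω i j).1 hij).mono (openGraph_mono h))

open Classical in
/-- Membership in a four-point atom is a statement about the profile. [this work] -/
theorem mem_atom_iff_prof (a b c y : Fin n) (π : Fin 4 → Fin 4) (ω : BondConfig (Fin n)) :
    ω ∈ atom (FourPointAtoms.quad a b c y) π ↔ prof a b c y ω = profOf π := by
  constructor
  · intro h
    funext i j
    have hij : (openGraph ω).Reachable (FourPointAtoms.quad a b c y i) (FourPointAtoms.quad a b c y j) ↔ π i = π j := h i j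
    unfold prof profOf
    exact decide_eq_decide.2 hij
  · intro h i j
    have := congrFun (congrFun h i) j
    unfold prof profOf at this
    exact decide_eq_decide.1 this

/-! ## Weights and the expansion of a cell -/

/-- The cylinder weight of the configuration `S` (all pairs of `Fin n` as coordinates). [this work] -/
def wt (w : Sym2 (Fin n) → unitInterval) (S : Finset (Sym2 (Fin n))) : ℝ :=
  ∏ e : Sym2 (Fin n), if e ∈ S then (w e : ℝ) else 1 - (w e : ℝ)

/-- Cylinder weights are nonnegative. [folklore] -/
theorem wt_nonneg (w : Sym2 (Fin n) → unitInterval) (S : Finset (Sym2 (Fin n))) : 0 ≤ wt w S := by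
  unfold wt
  refine Finset.prod_nonneg fun e _ => ?_
  split_ifs
  · exact (w e).2.1
  · linarith [(w e).2.2]

/-- **Expansion of a cell over configurations**: `cell i = Σ_S [prof S = profOf (pat4 i)] · wt S`. [this work] -/
theorem cell_eq_sum (w : Sym2 (Fin n) → unitInterval) (a b c y : Fin n) (i : Fin 15) :
    FourPointAtoms.cell w a b c y i =
      ∑ S : Finset (Sym2 (Fin n)), (if prof a b c y (↑S) = profOf (FourPointAtoms.pat4 i) then wt w S else 0) := by
  classical
  unfold FourPointAtoms.cell
  have hdet : DeterminedBy (atom (FourPointAtoms.quad a b c y) (FourPointAtoms.pat4 i))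
      (↑(Finset.univ : Finset (Sym2 (Fin n))) : Set (Sym2 (Fin n))) := by
    rw [determinedBy_iff]
    intro ω ω' h
    rw [Finset.coe_univ, Set.inter_univ, Set.inter_univ] at h
    rw [h]
  rw [Literature.Probability.Percolation.RussoPath.prodBernoulli_real_eq_sum_powerset hdet w]
  rw [Finset.powerset_univ]
  refine Finset.sum_congr rfl fun S _ => ?_
  have hm : ((↑S : Set (Sym2 (Fin n))) ∈ atom (FourPointAtoms.quad a b c y) (FourPointAtoms.pat4 i)) ↔
      prof a b c y (↑S) = profOf (FourPointAtoms.pat4 i) := mem_atom_iff_prof a b c y _ _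
  by_cases h : prof a b c y (↑S) = profOf (FourPointAtoms.pat4 i)
  · rw [if_pos (hm.2 h), if_pos h]; rfl
  · rw [if_neg (fun h' => h (hm.1 h')), if_neg h]

/-! ## The bilinear form as a sum over pairs, and its fibre decomposition -/

/-- The pair count `G(S, S') = liftK κ (prof S) (prof S')`. [this work] -/
theorem sum_kernel_cell_eq_pairs (κ : Fin 15 → Fin 15 → ℤ) (w : Sym2 (Fin n) → unitInterval) (a b c y : Fin n) :
    (∑ i : Fin 15, ∑ j : Fin 15, (κ i j : ℝ) * FourPointAtoms.cell w a b c y i * FourPointAtoms.cell w a b c y j) =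
      ∑ S : Finset (Sym2 (Fin n)), ∑ S' : Finset (Sym2 (Fin n)),
        (liftK κ (prof a b c y ↑S) (prof a b c y ↑S') : ℝ) * (wt w S * wt w S') := by
  classical
  -- both sides equal the quadruple sum of `X`
  set X : Fin 15 → Fin 15 → Finset (Sym2 (Fin n)) → Finset (Sym2 (Fin n)) → ℝ := fun i j S S' =>
    (if prof a b c y ↑S = profOf (FourPointAtoms.pat4 i) ∧ prof a b c y ↑S' = profOf (FourPointAtoms.pat4 j)
      then (κ i j : ℝ) else 0) * (wt w S * wt w S') with hX
  have hL : (∑ i : Fin 15, ∑ j : Fin 15, (κ i j : ℝ) * FourPointAtoms.cell w a b c y i * FourPointAtoms.cell w a b c y j)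
      = ∑ i : Fin 15, ∑ j : Fin 15, ∑ S : Finset (Sym2 (Fin n)), ∑ S' : Finset (Sym2 (Fin n)), X i j S S' := by
    refine Finset.sum_congr rfl fun i _ => Finset.sum_congr rfl fun j _ => ?_
    rw [cell_eq_sum, cell_eq_sum, mul_assoc, Finset.sum_mul_sum]
    simp only [Finset.mul_sum]
    refine Finset.sum_congr rfl fun S _ => Finset.sum_congr rfl fun S' _ => ?_
    rw [hX]
    by_cases h1 : prof a b c y ↑S = profOf (FourPointAtoms.pat4 i) <;>
      by_cases h2 : prof a b c y ↑S' = profOf (FourPointAtoms.pat4 j) <;> simp [h1, h2]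
  have hR : (∑ S : Finset (Sym2 (Fin n)), ∑ S' : Finset (Sym2 (Fin n)),
        (liftK κ (prof a b c y ↑S) (prof a b c y ↑S') : ℝ) * (wt w S * wt w S'))
      = ∑ S : Finset (Sym2 (Fin n)), ∑ S' : Finset (Sym2 (Fin n)), ∑ i : Fin 15, ∑ j : Fin 15, X i j S S' := by
    refine Finset.sum_congr rfl fun S _ => Finset.sum_congr rfl fun S' _ => ?_
    unfold liftK
    push_cast
    simp only [Finset.sum_mul, hX]
  rw [hL, hR]
  calc (∑ i : Fin 15, ∑ j : Fin 15, ∑ S : Finset (Sym2 (Fin n)), ∑ S' : Finset (Sym2 (Fin n)), X i j S S')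
      = ∑ i : Fin 15, ∑ S : Finset (Sym2 (Fin n)), ∑ S' : Finset (Sym2 (Fin n)), ∑ j : Fin 15, X i j S S' := by
        refine Finset.sum_congr rfl fun i _ => ?_
        rw [Finset.sum_comm]
        refine Finset.sum_congr rfl fun S _ => ?_
        rw [Finset.sum_comm]
    _ = ∑ S : Finset (Sym2 (Fin n)), ∑ S' : Finset (Sym2 (Fin n)), ∑ i : Fin 15, ∑ j : Fin 15, X i j S S' := by
        rw [Finset.sum_comm]
        refine Finset.sum_congr rfl fun S _ => ?_
        rw [Finset.sum_comm]

/-- The common weight of all pairs of a fibre `(M, C)`: `Π_{e∈C} w² · Π_{e∈M} w(1−w) · Π_{rest} (1−w)²`. [this work] -/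
def wt2 (w : Sym2 (Fin n) → unitInterval) (M C : Finset (Sym2 (Fin n))) : ℝ :=
  ∏ e : Sym2 (Fin n), if e ∈ C then (w e : ℝ) * (w e : ℝ) else
    if e ∈ M then (w e : ℝ) * (1 - (w e : ℝ)) else (1 - (w e : ℝ)) * (1 - (w e : ℝ))

/-- Fibre weights are nonnegative. [this work] -/
theorem wt2_nonneg (w : Sym2 (Fin n) → unitInterval) (M C : Finset (Sym2 (Fin n))) : 0 ≤ wt2 w M C := by
  unfold wt2
  refine Finset.prod_nonneg fun e _ => ?_
  have h0 := (w e).2.1; have h1 := (w e).2.2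
  split_ifs <;> nlinarith

/-- On the fibre `(M, C)` (`C ∩ M = ∅`) the pair weight is constant: `wt (C ∪ T) · wt (C ∪ (M ∖ T)) = wt2 M C`. [this work] -/
theorem wt_pair_eq (w : Sym2 (Fin n) → unitInterval) {M C T : Finset (Sym2 (Fin n))}
    (hT : T ⊆ M) : wt w (C ∪ T) * wt w (C ∪ (M \ T)) = wt2 w M C := by
  unfold wt wt2
  rw [← Finset.prod_mul_distrib]
  refine Finset.prod_congr rfl fun e _ => ?_
  by_cases hC : e ∈ C
  · have h1 : e ∈ C ∪ T := Finset.mem_union_left _ hC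
    have h2 : e ∈ C ∪ (M \ T) := Finset.mem_union_left _ hC
    rw [if_pos h1, if_pos h2, if_pos hC]
  · by_cases hM : e ∈ M
    · by_cases hTe : e ∈ T
      · have h1 : e ∈ C ∪ T := Finset.mem_union_right _ hTe
        have h2 : e ∉ C ∪ (M \ T) := by
          rw [Finset.mem_union, not_or, Finset.mem_sdiff, not_and, not_not]; exact ⟨hC, fun _ => hTe⟩
        rw [if_pos h1, if_neg h2, if_neg hC, if_pos hM]
      · have h1 : e ∉ C ∪ T := by rw [Finset.mem_union, not_or]; exact ⟨hC, hTe⟩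
        have h2 : e ∈ C ∪ (M \ T) := Finset.mem_union_right _ (Finset.mem_sdiff.2 ⟨hM, hTe⟩)
        rw [if_neg h1, if_pos h2, if_neg hC, if_pos hM]; ring
    · have h1 : e ∉ C ∪ T := by
        rw [Finset.mem_union, not_or]; exact ⟨hC, fun h => hM (hT h)⟩
      have h2 : e ∉ C ∪ (M \ T) := by
        rw [Finset.mem_union, not_or, Finset.mem_sdiff, not_and]; exact ⟨hC, fun h => absurd h hM⟩
      rw [if_neg h1, if_neg h2, if_neg hC, if_neg hM]

/-- Reindexing of pairs by fibres: `Σ_{S,S'} F(S,S') = Σ_M Σ_{C ⊆ Mᶜ} Σ_{T ⊆ M} F(C ∪ T, C ∪ (M ∖ T))`. [this work] -/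
theorem sum_pairs_eq_sum_fibres {β : Type*} [AddCommMonoid β] {γ : Type*} [Fintype γ] [DecidableEq γ]
    (F : Finset γ → Finset γ → β) :
    (∑ S : Finset γ, ∑ S' : Finset γ, F S S') =
      ∑ M : Finset γ, ∑ C ∈ (Mᶜ).powerset, ∑ T ∈ M.powerset, F (C ∪ T) (C ∪ (M \ T)) := by
  classical
  rw [← Finset.sum_product']
  rw [show (∑ M : Finset γ, ∑ C ∈ (Mᶜ).powerset, ∑ T ∈ M.powerset, F (C ∪ T) (C ∪ (M \ T))) =
      ∑ x ∈ (Finset.univ : Finset (Finset γ)).sigma (fun M => ((Mᶜ).powerset ×ˢ M.powerset)),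
        F (x.2.1 ∪ x.2.2) (x.2.1 ∪ (x.1 \ x.2.2)) from ?_]
  · symm
    refine Finset.sum_bij' (fun x _ => (x.2.1 ∪ x.2.2, x.2.1 ∪ (x.1 \ x.2.2)))
      (fun p _ => ⟨symmDiff p.1 p.2, (p.1 ∩ p.2, p.1 \ p.2)⟩) ?_ ?_ ?_ ?_ ?_
    · intro x hx; simp
    · intro p hp
      simp only [Finset.mem_sigma, Finset.mem_univ, Finset.mem_product, Finset.mem_powerset, true_and]
      constructor
      · intro e he
        simp only [Finset.mem_inter] at he
        simp only [Finset.mem_compl, Finset.mem_symmDiff, not_or, not_and, not_not]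
        exact ⟨fun _ => he.2, fun _ => he.1⟩
      · intro e he
        simp only [Finset.mem_sdiff] at he
        simp only [Finset.mem_symmDiff]
        exact Or.inl he
    · intro x hx
      obtain ⟨M, C, T⟩ := x
      simp only [Finset.mem_sigma, Finset.mem_univ, Finset.mem_product, Finset.mem_powerset, true_and] at hx
      obtain ⟨hC, hT⟩ := hx
      have hCM : Disjoint C M := by
        rw [Finset.disjoint_left]; intro e heC heM; exact (Finset.mem_compl.1 (hC heC)) heM
      simp only [Sigma.mk.injEq, heq_eq_eq, Prod.mk.injEq]
      refine ⟨?_, ?_, ?_⟩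
      · ext e
        simp only [Finset.mem_symmDiff, Finset.mem_union, Finset.mem_sdiff]
        constructor
        · rintro (⟨h1 | h1, h2⟩ | ⟨h1 | h1, h2⟩)
          · exact absurd (Or.inl h1) h2
          · exact hT h1
          · exact absurd (Or.inl h1) h2
          · exact h1.1
        · intro heM
          have heC : e ∉ C := fun h => (Finset.disjoint_left.1 hCM h) heM
          by_cases heT : e ∈ T
          · exact Or.inl ⟨Or.inr heT, fun h => h.elim heC (fun h => h.2 heT)⟩
          · exact Or.inr ⟨Or.inr ⟨heM, heT⟩, fun h => h.elim heC heT⟩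
      · ext e
        simp only [Finset.mem_inter, Finset.mem_union, Finset.mem_sdiff]
        constructor
        · rintro ⟨h1 | h1, h2 | h2⟩
          · exact h1
          · exact h1
          · exact h2
          · exact absurd h1 h2.2
        · intro h; exact ⟨Or.inl h, Or.inl h⟩
      · ext e
        simp only [Finset.mem_sdiff, Finset.mem_union, not_or, not_and, not_not]
        constructor
        · rintro ⟨h1 | h1, h2, h3⟩
          · exact absurd h1 h2
          · exact h1
        · intro heT
          have heC : e ∉ C := fun h => (Finset.disjoint_left.1 hCM h) (hT heT)
          exact ⟨Or.inr heT, heC, fun _ => heT⟩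
    · intro p hp
      obtain ⟨S, S'⟩ := p
      simp only [Prod.mk.injEq]
      constructor
      · ext e; simp only [Finset.mem_union, Finset.mem_inter, Finset.mem_sdiff]; tauto
      · ext e
        simp only [Finset.mem_union, Finset.mem_inter, Finset.mem_sdiff, Finset.mem_symmDiff]
        tauto
    · intro x hx; rfl
  · rw [Finset.sum_sigma]
    refine Finset.sum_congr rfl fun M _ => ?_
    rw [Finset.sum_product]

/-- **The bridge.**  A good kernel gives a nonnegative bilinear cell form on every finite weighted graph,
for all marked points `a b c y` (not necessarily distinct). [this work] -/
theorem sum_kernel_cell_nonneg {κ : Fin 15 → Fin 15 → ℤ} (hκ : GoodKernel κ)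
    (w : Sym2 (Fin n) → unitInterval) (a b c y : Fin n) :
    0 ≤ ∑ i : Fin 15, ∑ j : Fin 15, (κ i j : ℝ) * FourPointAtoms.cell w a b c y i * FourPointAtoms.cell w a b c y j := by
  classical
  rw [sum_kernel_cell_eq_pairs, sum_pairs_eq_sum_fibres]
  refine Finset.sum_nonneg fun M _ => Finset.sum_nonneg fun C hC => ?_
  rw [Finset.mem_powerset] at hC
  have hCM : Disjoint C M := by
    rw [Finset.disjoint_left]; intro e heC heM; exact (Finset.mem_compl.1 (hC heC)) heM
  -- factor out the constant weight of the fibre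
  have hrw : ∀ T ∈ M.powerset,
      (liftK κ (prof a b c y ↑(C ∪ T)) (prof a b c y ↑(C ∪ (M \ T))) : ℝ) * (wt w (C ∪ T) * wt w (C ∪ (M \ T))) =
        wt2 w M C * (liftK κ (prof a b c y ↑(C ∪ T)) (prof a b c y ↑(C ∪ (M \ T))) : ℝ) := by
    intro T hT
    rw [Finset.mem_powerset] at hT
    rw [wt_pair_eq w hT]; ring
  rw [Finset.sum_congr rfl hrw, ← Finset.mul_sum]
  refine mul_nonneg (wt2_nonneg w M C) ?_
  -- the antipodal count on the subsets of `M`, via the subtype `↥M`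
  let emb : Finset ↥M → Finset (Sym2 (Fin n)) := fun T => T.map (Function.Embedding.subtype _)
  let P : Finset ↥M → Prof := fun T => prof a b c y ↑(C ∪ emb T)
  have hmono : ∀ S T : Finset ↥M, S ⊆ T → ProfLE (P S) (P T) := by
    intro S T hST
    apply prof_mono
    intro e he
    simp only [Finset.coe_union, Set.mem_union, Finset.mem_coe] at he ⊢
    rcases he with he | he
    · exact Or.inl he
    · right
      simp only [emb, Finset.mem_map, Function.Embedding.coe_subtype] at he ⊢
      obtain ⟨x, hx, rfl⟩ := he
      exact ⟨x, hST hx, rfl⟩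
  have heqv : ∀ S : Finset ↥M, IsEqv (P S) := fun S => prof_isEqv a b c y _
  have hgood := hκ.nonneg (↥M) P hmono heqv
  -- reindex `Finset ↥M` ≃ `M.powerset`
  have hre : (∑ T : Finset ↥M, liftK κ (P T) (P Tᶜ)) =
      ∑ T ∈ M.powerset, liftK κ (prof a b c y ↑(C ∪ T)) (prof a b c y ↑(C ∪ (M \ T))) := by
    refine Finset.sum_bij' (fun T _ => emb T) (fun T _ => T.subtype (· ∈ M)) ?_ ?_ ?_ ?_ ?_
    · intro T _
      rw [Finset.mem_powerset]
      intro e he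
      simp only [emb, Finset.mem_map, Function.Embedding.coe_subtype] at he
      obtain ⟨x, _, rfl⟩ := he
      exact x.2
    · intro T _; exact Finset.mem_univ _
    · intro T _
      ext x
      simp [emb]
    · intro T hT
      rw [Finset.mem_powerset] at hT
      simp only [emb, Finset.subtype_map]
      exact Finset.filter_true_of_mem fun e he => hT he
    · intro T _
      have h1 : emb Tᶜ = M \ emb T := by
        ext e
        simp only [emb, Finset.mem_map, Function.Embedding.coe_subtype, Finset.mem_sdiff, Finset.mem_compl]
        constructor
        · rintro ⟨x, hx, rfl⟩
          exact ⟨x.2, fun ⟨x', hx', he⟩ => hx (by rwa [Subtype.ext he] at hx')⟩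
        · rintro ⟨heM, hne⟩
          exact ⟨⟨e, heM⟩, fun h => hne ⟨⟨e, heM⟩, h, rfl⟩, rfl⟩
      show liftK κ (P T) (P Tᶜ) = _
      simp only [P]
      rw [h1]
  have h := hgood
  rw [hre] at h
  exact_mod_cast h

end TwoCopyMono

end Summit.CriticalPhenomena.PercolationContinuityZ3.Theorems

end
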